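import Literature.NumberTheory.EllipticCurves.Phi64
import Literature.NumberTheory.EllipticCurves.TunnellFormsFrickeProofs
import Literature.NumberTheory.EllipticCurves.TunnellHalfIntegralFormsProofs
import HarnessLib

/-!
# `φ₆₄` at the cusp `u/8`: `φ₆₄(σ_u z) = -½ e((u+2δ)/8) (8z+δ)² Θ′(z) θ_odd(z)`

[[cite: Shimura1973HalfIntegral, §2 (transformation formulae of theta series)]] — for
`σ_u = (u β; 8 δ) ∈ SL₂(ℤ)` (`u` odd) we compute the two theta factors of `φ₆₄ = ½ Θ′ θ₄`
(`Phi64`) at `σ_u z`, with `w = 8z + δ`: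

* `thetaMul_four_sigma` — `θ(4σ_u z) = (-iw)^{1/2} e^{πiδ/4} θ_odd(z)`,
  `θ_odd(z) = ∑ₙ e((2n+1)² z)` (`thetaOdd`): `8σ_u z = u - 1/w`, `jacobiTheta(1 + τ) = θ₂(½, τ)`,
  and Jacobi's functional equation (Mathlib `jacobiTheta₂_functional_equation`) at `(w/2, w)`;
* `thetaChi_sigma` — `Θ′(σ_u z) = -(w/2)(16i/w)^{-1/2} · 8i e((u+δ)/8) Θ′(z)`, from the tree's
  `thetaChi_smul_eq_tsum` at `c = 8` and the Gauss sums modulo `8`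
  (`chiGaussSum_eight`: `G_χ(u, 2k'; 8) = 2e(u/8)(e(k'/4) - e(3k'/4)) = 4i e(u/8) χ₋₄(k')`,
  odd `k` vanish);
* **`phi64_sigma`** — the product, after the branch bookkeeping `(16/x)^{-1/2} x^{1/2} = x/4`
  (`branch_product`, `x = -iw`, `re x > 0`).

Numerically `-½ e((u+2δ)/8) Θ′ θ_odd = 2 e(-u/8) φ₃₂(2z)` (the level-`32` newform), the form in
which the expansion enters the diagonal Shintani coefficient of the route to
`tunnell_converse_even`.  No named facts; the definitions are `thetaOdd` and `sigmaSL`.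
-/

noncomputable section

open scoped MatrixGroups
open UpperHalfPlane hiding I
open Complex Real Filter Topology
open Literature.NumberTheory.EllipticCurves.ModularForms
open Literature.NumberTheory.EllipticCurves.Tunnell1983

namespace Literature.NumberTheory.EllipticCurves.Shintani


/-- `θ_odd(z) = ∑_{n ∈ ℤ} e((2n+1)² z) = ∑_{m odd} q^{m²}` as a function on `ℍ` (not to be
confused with the real-variable `q`-series `Literature.Analysis.SpecialFunctions.….thetaOdd` of
`ThetaJacobiIdentity`, which is `∑ q^{(2n+1)²}` for real `q`). [folklore] -/
def thetaOdd (z : ℍ) : ℂ := ∑' n : ℤ, cexp (2 * π * I * ((2 * n + 1) ^ 2 : ℤ) * (z : ℂ))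

/-- `jacobiTheta (1 + τ) = θ₂(1/2, τ) = ∑ (-1)ⁿ e^{πin²τ}` — a deliberate PRIVATE duplicate of
`Literature.NumberTheory.Automorphic.jacobiTheta_one_add` (`UnboundedDenominatorsReductions`),
whose import cone (vector-valued modular forms) is foreign to this file. [folklore] -/
private theorem jacobiTheta_one_add' (τ : ℂ) : jacobiTheta (1 + τ) = jacobiTheta₂ (1 / 2) τ := by
  rw [jacobiTheta_eq_jacobiTheta₂, jacobiTheta₂, jacobiTheta₂]
  refine tsum_congr fun n ↦ ?_
  rw [jacobiTheta₂_term, jacobiTheta₂_term]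
  -- `πi n² (1 + τ) = πi n² + πi n² τ` and `e^{πi n²} = e^{πi n}` (`n² - n` even)
  obtain ⟨k, hk⟩ : ∃ k : ℤ, n ^ 2 - n = 2 * k := by
    have : Even (n ^ 2 - n) := by
      rw [show n ^ 2 - n = n * (n - 1) by ring]; exact Int.even_mul_pred_self n
    obtain ⟨k, hk⟩ := this; exact ⟨k, by rw [hk]; ring⟩
  rw [show 2 * π * I * n * 0 + π * I * n ^ 2 * (1 + τ) =
      (k : ℂ) * (2 * π * I) + (2 * π * I * n * (1 / 2) + π * I * n ^ 2 * τ) by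
    have : (n : ℂ) ^ 2 = 2 * k + n := by exact_mod_cast (by linarith : (n : ℤ) ^ 2 = 2 * k + n)
    linear_combination (π * I) * this, Complex.exp_add, Complex.exp_int_mul_two_pi_mul_I, one_mul]

/-- `jacobiTheta (2k + τ) = jacobiTheta τ`. [folklore] -/
theorem jacobiTheta_two_mul_int_add (k : ℤ) (τ : ℂ) : jacobiTheta (2 * k + τ) = jacobiTheta τ := by
  have hp : Function.Periodic jacobiTheta 2 := fun x ↦ by rw [add_comm]; exact jacobiTheta_two_add x
  have := hp.int_mul k τ
  rw [add_comm, mul_comm] at this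
  exact this

/-- `θ₂(τ/2, τ) = ∑ₙ e^{πi(n²+n)τ}` as a series in `e(4n(n+1) z)` when `τ = 8z + δ`:
`θ₂(τ/2, τ) = ∑ₙ e(4n(n+1) z)` (`n² + n` is even, so the `δ`-part drops). [folklore] -/
theorem jacobiTheta₂_half_eq_tsum (z : ℍ) (δ : ℤ) :
    jacobiTheta₂ ((8 * (z : ℂ) + δ) / 2) (8 * (z : ℂ) + δ) =
      ∑' n : ℤ, cexp (2 * π * I * ((4 * (n ^ 2 + n) : ℤ)) * (z : ℂ)) := by
  rw [jacobiTheta₂]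
  refine tsum_congr fun n ↦ ?_
  rw [jacobiTheta₂_term]
  obtain ⟨k, hk⟩ : ∃ k : ℤ, n ^ 2 + n = 2 * k := by
    have : Even (n ^ 2 + n) := by
      rw [show n ^ 2 + n = n * (n + 1) by ring]; exact Int.even_mul_succ_self n
    obtain ⟨k, hk⟩ := this; exact ⟨k, by rw [hk]; ring⟩
  rw [show 2 * π * I * n * ((8 * (z : ℂ) + δ) / 2) + π * I * n ^ 2 * (8 * (z : ℂ) + δ) =
      ((k * δ : ℤ) : ℂ) * (2 * π * I) + 2 * π * I * ((4 * (n ^ 2 + n) : ℤ) : ℂ) * (z : ℂ) by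
    have : (n : ℂ) ^ 2 + n = 2 * k := by exact_mod_cast hk
    push_cast
    linear_combination (π * I * (δ : ℂ) + 0) * this + (0 : ℂ) * this, Complex.exp_add,
    Complex.exp_int_mul_two_pi_mul_I, one_mul]

/-- **`θ(4 σ_u z) = (-i(8z+δ))^{1/2} e^{πiδ/4} θ_odd(z)`** for `σ_u = (u β; 8 δ) ∈ SL₂(ℤ)`
(`u` odd): the expansion of `θ₄(z) = θ(4z)` at the cusp `u/8`.  Here `w₁` is the point `σ_u z`.
[cite: Shimura1973HalfIntegral, §2 (transformation formulae of `θ`)] -/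
theorem thetaMul_four_sigma (u β δ : ℤ) (hdet : u * δ - 8 * β = 1) (hu : Odd u) (z w₁ : ℍ)
    (hw : (w₁ : ℂ) = ((u : ℂ) * z + β) / (8 * (z : ℂ) + δ)) :
    thetaMul 4 w₁ = (-I * (8 * (z : ℂ) + δ)) ^ (1 / 2 : ℂ) * cexp (π * I * δ / 4) * thetaOdd z := by
  set τ₀ : ℂ := 8 * (z : ℂ) + δ with hτ₀
  have hτ₀im : 0 < τ₀.im := by simpa [hτ₀] using mul_pos (by norm_num : (0:ℝ) < 8) z.im_pos
  have hτ₀0 : τ₀ ≠ 0 := by rintro h; rw [h] at hτ₀im; simp at hτ₀im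
  obtain ⟨k, hk⟩ := hu
  -- `8 w₁ = u - 1/τ₀ = 2k + (1 + (-1/τ₀))`
  have h8w : 2 * (((4 : ℕ) : ℂ) * (w₁ : ℂ)) = 2 * k + (1 + (-1 / τ₀)) := by
    rw [hw]
    have hdet' : (u : ℂ) * δ - 8 * β = 1 := by exact_mod_cast hdet
    have hk' : (u : ℂ) = 2 * k + 1 := by exact_mod_cast hk
    have hτ : τ₀ = 8 * (z : ℂ) + δ := rfl
    field_simp
    rw [hτ]
    push_cast
    linear_combination (-1 : ℂ) * hdet' + (8 * (z : ℂ) + δ) * hk'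
  rw [thetaMul_eq_jacobiTheta (by norm_num) w₁, h8w, jacobiTheta_two_mul_int_add, jacobiTheta_one_add']
  -- functional equation at `(τ₀/2, τ₀)`
  have hFE := jacobiTheta₂_functional_equation (τ₀ / 2) τ₀
  have hsq : (-I * τ₀) ^ (1 / 2 : ℂ) ≠ 0 := by
    rw [Ne, Complex.cpow_eq_zero_iff, not_and_or]
    exact Or.inl (mul_ne_zero (neg_ne_zero.mpr Complex.I_ne_zero) hτ₀0)
  have hz2 : (τ₀ / 2) / τ₀ = 1 / 2 := by field_simp
  rw [hz2] at hFE
  have key : jacobiTheta₂ (1 / 2) (-1 / τ₀) =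
      (-I * τ₀) ^ (1 / 2 : ℂ) * cexp (π * I * τ₀ / 4) * jacobiTheta₂ (τ₀ / 2) τ₀ := by
    rw [hFE]
    field_simp
    rw [mul_assoc, ← Complex.exp_add, show τ₀ * I * π / 4 + -(τ₀ * I * π / 2 ^ 2) = 0 by ring,
      Complex.exp_zero, mul_one]
  rw [key, hτ₀, jacobiTheta₂_half_eq_tsum z δ, thetaOdd]
  -- `e^{πi τ₀/4} = e^{πiδ/4} e(z)` and `e(z) e(4(n²+n) z) = e((2n+1)² z)`
  set T₁ := ∑' n : ℤ, cexp (2 * π * I * ((4 * (n ^ 2 + n) : ℤ)) * (z : ℂ)) with hT₁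
  set T₂ := ∑' n : ℤ, cexp (2 * π * I * ((2 * n + 1) ^ 2 : ℤ) * (z : ℂ)) with hT₂
  have hT : cexp (2 * π * I * (z : ℂ)) * T₁ = T₂ := by
    rw [hT₁, hT₂, ← tsum_mul_left]
    refine tsum_congr fun n ↦ ?_
    rw [← Complex.exp_add]
    congr 1
    push_cast
    ring
  rw [show cexp (π * I * (8 * (z : ℂ) + δ) / 4) = cexp (π * I * δ / 4) * cexp (2 * π * I * (z : ℂ)) by
    rw [← Complex.exp_add]; congr 1; ring]
  rw [show ∀ A B C T : ℂ, A * (B * C) * T = A * B * (C * T) from fun A B C T ↦ by ring, hT]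



/-- `σ = (u β; 8 δ) ∈ SL₂(ℤ)`. [folklore] -/
def sigmaSL (u β δ : ℤ) (hdet : u * δ - 8 * β = 1) : SL(2, ℤ) :=
  ⟨!![u, β; 8, δ], by rw [Matrix.det_fin_two_of]; linarith⟩

/-- Entries of `sigmaSL`. [folklore] -/
theorem sigmaSL_apply (u β δ : ℤ) (hdet : u * δ - 8 * β = 1) :
    ((sigmaSL u β δ hdet) 0 0 : ℤ) = u ∧ ((sigmaSL u β δ hdet) 0 1 : ℤ) = β ∧
      ((sigmaSL u β δ hdet) 1 0 : ℤ) = 8 ∧ ((sigmaSL u β δ hdet) 1 1 : ℤ) = δ := by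
  refine ⟨rfl, rfl, rfl, rfl⟩

/-- `e(n) = 1` for an integer `n` (a private one-line wrapper of Mathlib's
`Complex.exp_int_mul_two_pi_mul_I` in the argument order used below). [folklore] -/
private theorem cexp_two_pi_I_int (n : ℤ) : cexp (2 * Real.pi * I * n) = 1 := by
  rw [show 2 * Real.pi * I * n = n * (2 * Real.pi * I) by ring]; exact Complex.exp_int_mul_two_pi_mul_I n

/-- **The Gauss sums modulo `8`**: `G_χ(u, 2k'; 8) = 2 e(u/8) (e(k'/4) - e(3k'/4))` for every
integer `u` (the odd residues `r = 1, 3, 5, 7` have `r² ≡ 1 (mod 8)` and `χ₋₄(r) = 1, -1, 1, -1`).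
[folklore] -/
theorem chiGaussSum_eight (u k' : ℤ) :
    chiGaussSum (c := 8) (by norm_num) (u : ZMod 8) ((2 * k' : ℤ) : ZMod 8) =
      2 * cexp (2 * Real.pi * I * u / 8) *
        (cexp (2 * Real.pi * I * k' / 4) - cexp (2 * Real.pi * I * (3 * k') / 4)) := by
  rw [chiGaussSum_eq_sum_range (c := 8) (by norm_num) u (2 * k')]
  simp only [Finset.sum_range_succ, Finset.sum_range_zero, zero_add]
  -- the character values
  have hv : ∀ (n v : ℤ), ZMod.χ₄ (n : ZMod 4) = v → chiM4 n = v := fun n v h ↦ by unfold chiM4; rw [h]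
  rw [hv ((0 : ℕ) : ℤ) 0 (by decide), hv ((1 : ℕ) : ℤ) 1 (by decide), hv ((2 : ℕ) : ℤ) 0 (by decide),
    hv ((3 : ℕ) : ℤ) (-1) (by decide), hv ((4 : ℕ) : ℤ) 0 (by decide), hv ((5 : ℕ) : ℤ) 1 (by decide),
    hv ((6 : ℕ) : ℤ) 0 (by decide), hv ((7 : ℕ) : ℤ) (-1) (by decide)]
  push_cast
  simp only [zero_mul, one_mul, neg_one_mul, add_zero, zero_add]
  -- the four exponentials
  have e1 : cexp (2 * Real.pi * I * ((u : ℂ) * 1 + 2 * (k' : ℂ) * 1) / 8) =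
      cexp (2 * Real.pi * I * u / 8) * cexp (2 * Real.pi * I * k' / 4) := by
    rw [← Complex.exp_add]; congr 1; ring
  have e3 : cexp (2 * Real.pi * I * ((u : ℂ) * 9 + 2 * (k' : ℂ) * 3) / 8) =
      cexp (2 * Real.pi * I * u / 8) * cexp (2 * Real.pi * I * (3 * k') / 4) := by
    rw [← Complex.exp_add, show 2 * Real.pi * I * ((u : ℂ) * 9 + 2 * (k' : ℂ) * 3) / 8 =
      (2 * Real.pi * I * u / 8 + 2 * Real.pi * I * (3 * k') / 4) + 2 * Real.pi * I * (u : ℤ) by ring,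
      Complex.exp_add, cexp_two_pi_I_int, mul_one]
  have e5 : cexp (2 * Real.pi * I * ((u : ℂ) * 25 + 2 * (k' : ℂ) * 5) / 8) =
      cexp (2 * Real.pi * I * u / 8) * cexp (2 * Real.pi * I * k' / 4) := by
    rw [← Complex.exp_add, show 2 * Real.pi * I * ((u : ℂ) * 25 + 2 * (k' : ℂ) * 5) / 8 =
      (2 * Real.pi * I * u / 8 + 2 * Real.pi * I * k' / 4) + 2 * Real.pi * I * ((3 * u + k' : ℤ)) by push_cast; ring,
      Complex.exp_add, cexp_two_pi_I_int, mul_one]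
  have e7 : cexp (2 * Real.pi * I * ((u : ℂ) * 49 + 2 * (k' : ℂ) * 7) / 8) =
      cexp (2 * Real.pi * I * u / 8) * cexp (2 * Real.pi * I * (3 * k') / 4) := by
    rw [← Complex.exp_add, show 2 * Real.pi * I * ((u : ℂ) * 49 + 2 * (k' : ℂ) * 7) / 8 =
      (2 * Real.pi * I * u / 8 + 2 * Real.pi * I * (3 * k') / 4) + 2 * Real.pi * I * ((6 * u + k' : ℤ)) by push_cast; ring,
      Complex.exp_add, cexp_two_pi_I_int, mul_one]
  rw [e1, e3, e5, e7]
  ring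

/-- For odd `k'`: `e(k'/4) - e(3k'/4) = 2i χ₋₄(k')`; for even `k'` it is `0 = 2i χ₋₄(k')`. [folklore] -/
theorem cexp_quarter_sub (k' : ℤ) :
    cexp (2 * Real.pi * I * k' / 4) - cexp (2 * Real.pi * I * (3 * k') / 4) = 2 * I * chiM4 k' := by
  -- reduce to `k' mod 4`
  set r : ℤ := k' % 4 with hr
  set j : ℤ := k' / 4 with hj
  have hk : k' = r + 4 * j := by rw [hr, hj]; omega
  have hr0 : 0 ≤ r := Int.emod_nonneg _ (by norm_num)
  have hr4 : r < 4 := Int.emod_lt_of_pos _ (by norm_num)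
  have hA : cexp (2 * Real.pi * I * k' / 4) = cexp (2 * Real.pi * I * r / 4) := by
    rw [hk, show 2 * Real.pi * I * ((r + 4 * j : ℤ) : ℂ) / 4 = 2 * Real.pi * I * r / 4 + 2 * Real.pi * I * (j : ℤ) by
      push_cast; ring, Complex.exp_add, cexp_two_pi_I_int, mul_one]
  have hB : cexp (2 * Real.pi * I * (3 * k') / 4) = cexp (2 * Real.pi * I * (3 * r) / 4) := by
    rw [hk, show 2 * Real.pi * I * (3 * ((r + 4 * j : ℤ) : ℂ)) / 4 = 2 * Real.pi * I * (3 * r) / 4 + 2 * Real.pi * I * ((3 * j : ℤ)) by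
      push_cast; ring, Complex.exp_add, cexp_two_pi_I_int, mul_one]
  have hC : chiM4 k' = chiM4 r := by rw [hk]; exact chiM4_add_four_mul r j
  rw [hA, hB, hC]
  have hv : ∀ (n v : ℤ), ZMod.χ₄ (n : ZMod 4) = v → chiM4 n = v := fun n v h ↦ by unfold chiM4; rw [h]
  have hI : cexp (2 * Real.pi * I * (1 : ℤ) / 4) = I := by
    rw [show 2 * Real.pi * I * ((1 : ℤ) : ℂ) / 4 = Real.pi / 2 * I by push_cast; ring, Complex.exp_pi_div_two_mul_I]
  have hI2 : cexp (2 * Real.pi * I * (2 : ℤ) / 4) = -1 := by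
    rw [show 2 * Real.pi * I * ((2 : ℤ) : ℂ) / 4 = Real.pi * I by push_cast; ring, Complex.exp_pi_mul_I]
  have hI3 : cexp (2 * Real.pi * I * (3 : ℤ) / 4) = -I := by
    rw [show 2 * Real.pi * I * ((3 : ℤ) : ℂ) / 4 = Real.pi / 2 * I + Real.pi * I by push_cast; ring,
      Complex.exp_add, Complex.exp_pi_div_two_mul_I, Complex.exp_pi_mul_I]; ring
  have hI6 : cexp (2 * Real.pi * I * (3 * (2 : ℤ)) / 4) = -1 := by
    rw [show 2 * Real.pi * I * (3 * ((2 : ℤ) : ℂ)) / 4 = Real.pi * I + 2 * Real.pi * I * ((1 : ℤ)) by push_cast; ring,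
      Complex.exp_add, Complex.exp_pi_mul_I, cexp_two_pi_I_int]; ring
  have hI9 : cexp (2 * Real.pi * I * (3 * (3 : ℤ)) / 4) = I := by
    rw [show 2 * Real.pi * I * (3 * ((3 : ℤ) : ℂ)) / 4 = Real.pi / 2 * I + 2 * Real.pi * I * ((2 : ℤ)) by push_cast; ring,
      Complex.exp_add, Complex.exp_pi_div_two_mul_I, cexp_two_pi_I_int]; ring
  interval_cases r
  · rw [hv 0 0 (by decide)]; simp
  · rw [hv 1 1 (by decide), hI, show (3 * ((1 : ℤ) : ℂ)) = ((3 : ℤ) : ℂ) by push_cast; ring, hI3]; push_cast; ring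
  · rw [hv 2 0 (by decide), hI2, hI6]; push_cast; ring
  · rw [hv 3 (-1) (by decide), hI3, hI9]; push_cast; ring

/-- `χ₋₄(k') e^{πi k'² δ/4} = χ₋₄(k') e^{πiδ/4}` (for odd `k'`, `k'² ≡ 1 (mod 8)`; for even `k'` both
sides vanish). [folklore] -/
theorem chiM4_mul_cexp_sq (k' δ : ℤ) :
    chiM4 k' * cexp (Real.pi * I * k' ^ 2 * δ / 4) = chiM4 k' * cexp (Real.pi * I * δ / 4) := by
  rcases Int.even_or_odd k' with hk | hk
  · rw [chiM4_eq_zero_of_even hk]; simp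
  · obtain ⟨j, rfl⟩ := hk
    congr 1
    -- `(2j+1)² = 8 (j(j+1)/2) + 1`
    obtain ⟨m, hm⟩ : ∃ m : ℤ, j ^ 2 + j = 2 * m := by
      have : Even (j ^ 2 + j) := by rw [show j ^ 2 + j = j * (j + 1) by ring]; exact Int.even_mul_succ_self j
      obtain ⟨m, hm⟩ := this; exact ⟨m, by rw [hm]; ring⟩
    rw [show (Real.pi * I * ((2 * j + 1 : ℤ) : ℂ) ^ 2 * δ / 4) = Real.pi * I * δ / 4 + 2 * Real.pi * I * ((m * δ : ℤ)) by
      have : ((j : ℂ)) ^ 2 + j = 2 * m := by exact_mod_cast hm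
      push_cast
      linear_combination (Real.pi * I * (δ : ℂ)) * this, Complex.exp_add, cexp_two_pi_I_int, mul_one]

/-- **`Θ′(σ_u z)`** for `σ_u = (u β; 8 δ)`: with `w = 8z + δ`,
`Θ′(σ_u z) = -(w/2) (w/(16 i))^{1/2} · 8i e((u+δ)/8) · Θ′(z)` — i.e. `Θ′` is an eigenfunction of
`σ_u` in weight `3/2`.  From the general law `thetaChi_smul_eq_tsum` at `c = 8` and the Gauss sums
modulo `8` (`chiGaussSum_eight`, odd `k` vanish). [cite: Shimura1973HalfIntegral, §2] -/
theorem thetaChi_sigma (u β δ : ℤ) (hdet : u * δ - 8 * β = 1) (z : ℍ) :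
    thetaChi ((sigmaSL u β δ hdet) • z) =
      -((8 * (z : ℂ) + δ) / 2) * (1 / (2 * I * 8 / (8 * (z : ℂ) + δ)) ^ (1 / 2 : ℂ)) *
        (8 * I * cexp (2 * Real.pi * I * (u + δ) / 8) * thetaChi z) := by
  have h := thetaChi_smul_eq_tsum (c := 8) (γ := sigmaSL u β δ hdet) rfl (by norm_num) z
  rw [show (((sigmaSL u β δ hdet) 1 1 : ℤ) : ℂ) = δ from rfl,
    show ((sigmaSL u β δ hdet) 0 0 : ℤ) = u from rfl] at h
  push_cast at h
  rw [h]
  congr 1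
  -- the series: even `k = 2k'` give `8i e((u+δ)/8) Θ′`-terms, odd `k` vanish
  set w : ℂ := 8 * (z : ℂ) + δ with hw
  have hterm : ∀ k' : ℤ, ((2 * k' : ℤ) : ℂ) * cexp (Real.pi * I * ((2 * k' : ℤ) : ℂ) ^ 2 * (w / (2 * 8))) *
      chiGaussSum (c := 8) (by norm_num) (u : ZMod 8) ((2 * k' : ℤ) : ZMod 8) =
      8 * I * cexp (2 * Real.pi * I * (u + δ) / 8) * thetaChiTerm z k' := by
    intro k'
    rw [chiGaussSum_eight, cexp_quarter_sub, thetaChiTerm]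
    have hexp : cexp (Real.pi * I * ((2 * k' : ℤ) : ℂ) ^ 2 * (w / (2 * 8))) =
        cexp (2 * Real.pi * I * k' ^ 2 * (z : ℂ)) * cexp (Real.pi * I * k' ^ 2 * δ / 4) := by
      rw [← Complex.exp_add]; congr 1; rw [hw]; push_cast; ring
    rw [hexp]
    have hc := chiM4_mul_cexp_sq k' δ
    -- rearrange so that `χ(k') e^{πik'²δ/4}` appears
    calc ((2 * k' : ℤ) : ℂ) * (cexp (2 * Real.pi * I * k' ^ 2 * (z : ℂ)) * cexp (Real.pi * I * k' ^ 2 * δ / 4)) *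
          (2 * cexp (2 * Real.pi * I * u / 8) * (2 * I * chiM4 k'))
        = 8 * I * cexp (2 * Real.pi * I * u / 8) * (k' * cexp (2 * Real.pi * I * k' ^ 2 * (z : ℂ))) *
            (chiM4 k' * cexp (Real.pi * I * k' ^ 2 * δ / 4)) := by push_cast; ring
      _ = 8 * I * cexp (2 * Real.pi * I * u / 8) * (k' * cexp (2 * Real.pi * I * k' ^ 2 * (z : ℂ))) *
            (chiM4 k' * cexp (Real.pi * I * δ / 4)) := by rw [hc]
      _ = 8 * I * (cexp (2 * Real.pi * I * u / 8) * cexp (Real.pi * I * δ / 4)) *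
            (chiM4 k' * k' * cexp (2 * Real.pi * I * k' ^ 2 * (z : ℂ))) := by ring
      _ = _ := by rw [← Complex.exp_add]; congr 2; ring
  have he : HasSum (fun k' : ℤ ↦ (((2 * k' : ℤ)) : ℂ) * cexp (Real.pi * I * ((2 * k' : ℤ) : ℂ) ^ 2 * (w / (2 * 8))) *
      chiGaussSum (c := 8) (by norm_num) (u : ZMod 8) ((2 * k' : ℤ) : ZMod 8)) (8 * I * cexp (2 * Real.pi * I * (u + δ) / 8) * thetaChi z) := by
    have := (hasSum_thetaChi z).mul_left (8 * I * cexp (2 * Real.pi * I * (u + δ) / 8))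
    refine this.congr_fun fun k' ↦ ?_
    rw [← hterm k']
  have ho : HasSum (fun k' : ℤ ↦ (((2 * k' + 1 : ℤ)) : ℂ) * cexp (Real.pi * I * ((2 * k' + 1 : ℤ) : ℂ) ^ 2 * (w / (2 * 8))) *
      chiGaussSum (c := 8) (by norm_num) (u : ZMod 8) ((2 * k' + 1 : ℤ) : ZMod 8)) 0 := by
    have : (fun k' : ℤ ↦ (((2 * k' + 1 : ℤ)) : ℂ) * cexp (Real.pi * I * ((2 * k' + 1 : ℤ) : ℂ) ^ 2 * (w / (2 * 8))) *
        chiGaussSum (c := 8) (by norm_num) (u : ZMod 8) ((2 * k' + 1 : ℤ) : ZMod 8)) = fun _ ↦ 0 := by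
      funext k'
      have h0 := chiGaussSum_eq_zero_of_odd (c := 8) (by norm_num) (by norm_num) (u : ZMod 8) (k := 2 * k' + 1) ⟨k', rfl⟩
      push_cast at h0 ⊢
      rw [h0, mul_zero]
    rw [this]; exact hasSum_zero
  have htot := ModularForms.hasSum_int_even_add_odd (f := fun k : ℤ ↦ (k : ℂ) * cexp (Real.pi * I * (k : ℂ) ^ 2 * (w / (2 * 8))) *
      chiGaussSum (c := 8) (by norm_num) (u : ZMod 8) (k : ZMod 8)) (by exact_mod_cast he) (by exact_mod_cast ho)
  rw [add_zero] at htot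
  have := htot.tsum_eq
  push_cast at this
  exact this



/-! ### Branch bookkeeping -/

/-- For `re x > 0`: `(1/(16/x)^{1/2}) · x^{1/2} = x/4`. [folklore] -/
theorem branch_product {x : ℂ} (hx : 0 < x.re) :
    1 / ((16 : ℂ) / x) ^ (1 / 2 : ℂ) * x ^ (1 / 2 : ℂ) = x / 4 := by
  have hx0 : x ≠ 0 := by rintro rfl; simp at hx
  have harg : x.arg ≠ Real.pi := by
    have h := (Complex.abs_arg_lt_pi_div_two_iff (z := x)).mpr (Or.inl hx)
    intro hπ; rw [hπ, abs_of_pos Real.pi_pos] at h; linarith [Real.pi_pos]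
  -- `(16/x)^{1/2} = 4 (x⁻¹)^{1/2} = 4 / x^{1/2}`
  have h16 : ((16 : ℂ) / x) ^ (1 / 2 : ℂ) = 4 * (x ^ (1 / 2 : ℂ))⁻¹ := by
    rw [div_eq_mul_inv, show (16 : ℂ) = ((16 : ℝ) : ℂ) by norm_num,
      Complex.cpow_def_of_ne_zero (mul_ne_zero (by norm_num) (inv_ne_zero hx0)),
      Complex.log_ofReal_mul (by norm_num) (inv_ne_zero hx0), add_mul, Complex.exp_add,
      ← Complex.cpow_def_of_ne_zero (inv_ne_zero hx0), Complex.inv_cpow _ _ harg]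
    congr 1
    rw [show (((Real.log 16 : ℝ)) : ℂ) * (1 / 2 : ℂ) = (((Real.log 16 / 2 : ℝ)) : ℂ) by push_cast; ring,
      ← Complex.ofReal_exp, show Real.log 16 / 2 = Real.log 4 by
        rw [show (16 : ℝ) = 4 ^ 2 by norm_num, Real.log_pow]; ring, Real.exp_log (by norm_num)]
    norm_num
  have hsq : x ^ (1 / 2 : ℂ) ≠ 0 := by
    rw [Ne, Complex.cpow_eq_zero_iff, not_and_or]; exact Or.inl hx0
  have hxx : x ^ (1 / 2 : ℂ) * x ^ (1 / 2 : ℂ) = x := by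
    rw [← Complex.cpow_add _ _ hx0]; norm_num
  rw [h16]
  field_simp
  rw [sq, hxx]

/-! ### `φ₆₄` at the cusp `u/8` -/

/-- The coordinate of `σ_u z`. [folklore] -/
theorem coe_sigmaSL_smul (u β δ : ℤ) (hdet : u * δ - 8 * β = 1) (z : ℍ) :
    ((((sigmaSL u β δ hdet) • z : ℍ)) : ℂ) = ((u : ℂ) * z + β) / (8 * (z : ℂ) + δ) := by
  rw [UpperHalfPlane.specialLinearGroup_apply]
  simp [sigmaSL]

/-- **`φ₆₄(σ_u z) = -½ e((u + 2δ)/8) (8z+δ)² Θ′(z) θ_odd(z)`** for `σ_u = (u β; 8 δ) ∈ SL₂(ℤ)`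
(`u` odd): the expansion of `φ₆₄ = ½ Θ′ θ₄` at the cusp `u/8` is `-½ e((u+2δ)/8) Θ′ θ_odd`
(numerically `= 2 e(-u/8) φ₃₂(2z)`). [cite: Shimura1973HalfIntegral, §2] -/
theorem phi64_sigma (u β δ : ℤ) (hdet : u * δ - 8 * β = 1) (hu : Odd u) (z : ℍ) :
    phi64 ((sigmaSL u β δ hdet) • z) =
      -(1 / 2) * cexp (2 * Real.pi * I * (u + 2 * δ) / 8) * (8 * (z : ℂ) + δ) ^ 2 * (thetaChi z * thetaOdd z) := by
  have hA := thetaChi_sigma u β δ hdet z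
  have hB := thetaMul_four_sigma u β δ hdet hu z _ (coe_sigmaSL_smul u β δ hdet z)
  rw [phi64, hA, hB]
  set w : ℂ := 8 * (z : ℂ) + δ with hw
  set x : ℂ := -I * w with hx
  have hwim : 0 < w.im := by simpa [hw] using mul_pos (by norm_num : (0:ℝ) < 8) z.im_pos
  have hxre : 0 < x.re := by simpa [hx] using hwim
  have hw0 : w ≠ 0 := by rintro h; rw [h] at hwim; simp at hwim
  have h1 : 2 * I * 8 / w = 16 / x := by
    rw [hx]; field_simp; rw [Complex.I_sq]; ring
  have hb := branch_product hxre
  rw [h1]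
  have he : cexp (2 * Real.pi * I * (u + δ) / 8) * cexp (Real.pi * I * δ / 4) =
      cexp (2 * Real.pi * I * (u + 2 * δ) / 8) := by
    rw [← Complex.exp_add]; congr 1; ring
  calc -(w / 2) * (1 / ((16 : ℂ) / x) ^ (1 / 2 : ℂ)) * (8 * I * cexp (2 * Real.pi * I * (u + δ) / 8) * thetaChi z) *
        (x ^ (1 / 2 : ℂ) * cexp (Real.pi * I * δ / 4) * thetaOdd z) / 2
      = -(w / 2) * (8 * I) / 2 * (1 / ((16 : ℂ) / x) ^ (1 / 2 : ℂ) * x ^ (1 / 2 : ℂ)) *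
          (cexp (2 * Real.pi * I * (u + δ) / 8) * cexp (Real.pi * I * δ / 4)) * (thetaChi z * thetaOdd z) := by ring
    _ = -(w / 2) * (8 * I) / 2 * (x / 4) * cexp (2 * Real.pi * I * (u + 2 * δ) / 8) * (thetaChi z * thetaOdd z) := by
          rw [hb, he]
    _ = _ := by
          rw [hx]
          have hI : I * I = -1 := Complex.I_mul_I
          linear_combination (w ^ 2 / 2 * cexp (2 * Real.pi * I * (u + 2 * δ) / 8) * (thetaChi z * thetaOdd z)) * hI


end Literature.NumberTheory.EllipticCurves.Shintani
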